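import Literature.MathematicalPhysics.QuantumLattice.UncertaintyPrincipleInequality
import Literature.MathematicalPhysics.QuantumLattice.ProductOperators
import HarnessLib

/-!
# The uncertainty-principle (Goldstone) lower bound on transverse fluctuations of a spin state

Pitaevskii–Stringari's `T = 0` substitute for the Bogoliubov inequality,
`⟨{A†,A}⟩⟨{B†,B}⟩ ≥ |⟨[A†,B]⟩|²` [cite: Stringari1995, §2.2 eq. (8)] [cite: PitaevskiiStringari1991]
(`UncertaintyPrincipleInequality.norm_sq_expect_commutator_le`), turns an ORDER PARAMETER that is a
commutator expectation into a LOWER bound on a fluctuation (Stringari's (9): `n(q) ≥ n₀/(4S(q)) - ½`).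
For a `U(1)`-symmetric finite-volume state the commutator `⟨[S⁺(k), Sᶻ(-k)]⟩ = -⟨S⁺_tot⟩` vanishes,
so one uses the COMPOSITE probe `B = Sᶻ(k)† S⁻_tot`: for every vector `ψ` of a finite spin system
`(ℂ^{n+1})^{⊗Λ}` and every unimodular weight `c : Λ → ℂ` (`c_x c̄_x = 1`; `c_x = e^{-ik·x}` on a
torus), with `S⁺(c) = Σ_x c_x S⁺_x`, `S⁻(c̄) = S⁺(c)†`, `Z(c) = Σ_x c_x Sᶻ_x`, `S^±_tot = Σ_x S^±_x`,

`[S⁺(c), Z(c)† S⁻_tot] = -S⁺_tot S⁻_tot + 2 Z(c)† Z(c)`   (`goldstone_commutator`), hence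

`(2‖Z(c)ψ‖² - ‖S⁻_tot ψ‖²)² ≤ (‖S⁻(c̄)ψ‖² + ‖S⁺(c)ψ‖²) · ((‖S⁻_tot Z(c)†ψ‖ + ‖S⁻(c̄)ψ‖)² + ‖S⁺_tot Z(c)ψ‖²)`

(`goldstone_uncertainty_bound`). Reading (translation-invariant `ψ` in the `Sᶻ_tot = 0` sector of an
`N`-site torus, `c_x = e^{-ik·x}`, `k ≠ 0`): `‖S⁻_totψ‖² = N²m²` is the planar long-range order,
`‖Z(c)ψ‖² = N Ĉ(k)`, `‖S^∓(c)ψ‖² = N K̂(k)`, and `‖S^∓_tot φ‖ ≤ s_N ‖φ‖` on the sector, so the bound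
is `K̂(k)·Ĉ(k) ≥ m⁴ (1 - o(1))`: a macroscopic condensate forces transverse spectral weight at EVERY
momentum, inversely to the longitudinal (density) structure factor — the finite-volume, symmetric-
state form of the `T = 0` Goldstone `1/|k|` law (with an infrared bound `Ĉ(k) = O(|k|)` such as
`XXZIsingInfraredBound.xxz_isingStructureFactor_infraredBound`). No Hamiltonian and no symmetry of
`ψ` is used here; everything is PROVED, no definition is introduced.

## Main statements

* `sum_smul_onSite_commutator` — `[Σ_x a_x p_x, Σ_y b_y q_y] = Σ_x a_x b_x [p,q]_x` for single-site
  matrices `p`, `q` (locality).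
* `goldstone_commutator` — the composite-probe commutator above.
* `goldstone_uncertainty_bound` — the inequality above.
* Spin ½ (section `SpinHalf`): `spinRaise_one_mul_spinLower_one_add` (`S⁺S⁻ + S⁻S⁺ = 1`),
  `eucNorm_sum_onSite_spinLower_one_mulVec_le` / `…spinRaise…` (`‖S^∓_tot φ‖ ≤ |Λ|‖φ‖`), and
  `goldstone_uncertainty_bound_spinHalf` — the bound with the explicit constant `|Λ|`.

## References

* [PitaevskiiStringari1991] L. Pitaevskii, S. Stringari, J. Low Temp. Phys. 85 (1991) 377, §2.
* [Stringari1995] S. Stringari, in: Bose–Einstein Condensation (CUP 1995), §2.2 (8)–(9).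
* H. Tasaki, *Physics and Mathematics of Quantum Many-Body Systems* (Springer 2020), §2.1–2.2
  (spin commutators, locality).
-/

noncomputable section

namespace Literature.MathematicalPhysics.QuantumLattice

open Matrix Finset Complex

variable {Λ : Type*} [Fintype Λ] [DecidableEq Λ] (n : ℕ)

/-- **Locality of weighted sums of single-site operators**: for single-site matrices `p`, `q` and
weights `a`, `b`, `[Σ_x a_x p_x, Σ_y b_y q_y] = Σ_x a_x b_x (pq - qp)_x` (operators at distinct sites
commute). [cite: Tasaki2020, §2.2 eq. (2.2.6)] -/
theorem sum_smul_onSite_commutator {m : ℕ} (a b : Λ → ℂ) (p q : Matrix (Fin m) (Fin m) ℂ) :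
    (∑ x, a x • (onSite x p : Op Λ m)) * (∑ y, b y • (onSite y q : Op Λ m)) -
        (∑ y, b y • (onSite y q : Op Λ m)) * (∑ x, a x • (onSite x p : Op Λ m)) =
      ∑ x, (a x * b x) • (onSite x (p * q - q * p) : Op Λ m) := by
  have h1 : (∑ x, a x • (onSite x p : Op Λ m)) * (∑ y, b y • (onSite y q : Op Λ m)) =
      ∑ x, ∑ y, (a x * b y) • ((onSite x p : Op Λ m) * onSite y q) := by
    rw [Finset.sum_mul]
    refine sum_congr rfl fun x _ => ?_
    rw [Finset.mul_sum]
    refine sum_congr rfl fun y _ => ?_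
    rw [smul_mul_smul_comm]
  have h2 : (∑ y, b y • (onSite y q : Op Λ m)) * (∑ x, a x • (onSite x p : Op Λ m)) =
      ∑ x, ∑ y, (a x * b y) • ((onSite y q : Op Λ m) * onSite x p) := by
    rw [Finset.mul_sum]
    refine sum_congr rfl fun x _ => ?_
    rw [Finset.sum_mul]
    refine sum_congr rfl fun y _ => ?_
    rw [smul_mul_smul_comm, mul_comm (b y) (a x)]
  rw [h1, h2, ← Finset.sum_sub_distrib]
  refine sum_congr rfl fun x _ => ?_
  rw [← Finset.sum_sub_distrib]
  rw [Finset.sum_eq_single x]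
  · rw [← smul_sub, onSite_mul, onSite_mul, ← onSite_sub']
  · intro y _ hyx
    rw [← smul_sub, onSite_mul_onSite_comm (Ne.symm hyx), sub_self, smul_zero]
  · intro hx; exact absurd (mem_univ x) hx

/-- **The composite-probe commutator** (`c` unimodular):
`[S⁺(c), Z(c)† S⁻_tot] = -S⁺_tot S⁻_tot + 2 Z(c)† Z(c)`, where `S⁺(c) = Σ c_x S⁺_x`,
`Z(c)† = Σ c̄_x Sᶻ_x`, `Z(c) = Σ c_x Sᶻ_x`, `S^±_tot = Σ S^±_x`; from `[S⁺_x, Sᶻ_y] = -δ_{xy}S⁺_x` and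
`[S⁺_x, S⁻_y] = 2δ_{xy}Sᶻ_x`. [cite: Tasaki2020, §2.1 eq. (2.1.7)] -/
theorem goldstone_commutator (c : Λ → ℂ) (hc : ∀ x, c x * star (c x) = 1) :
    (∑ x, c x • (onSite x (spinRaise n) : Op Λ (n + 1))) *
        ((∑ x, star (c x) • (onSite x (SpinOperators.spinZ n) : Op Λ (n + 1))) *
          ∑ x, (onSite x (spinLower n) : Op Λ (n + 1))) -
      ((∑ x, star (c x) • (onSite x (SpinOperators.spinZ n) : Op Λ (n + 1))) *
          ∑ x, (onSite x (spinLower n) : Op Λ (n + 1))) *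
        (∑ x, c x • (onSite x (spinRaise n) : Op Λ (n + 1))) =
      -((∑ x, (onSite x (spinRaise n) : Op Λ (n + 1))) * ∑ x, (onSite x (spinLower n) : Op Λ (n + 1))) +
        (2 : ℂ) • ((∑ x, star (c x) • (onSite x (SpinOperators.spinZ n) : Op Λ (n + 1))) *
          ∑ x, c x • (onSite x (SpinOperators.spinZ n) : Op Λ (n + 1))) := by
  set R : Op Λ (n + 1) := ∑ x, c x • (onSite x (spinRaise n) : Op Λ (n + 1)) with hR
  set Zs : Op Λ (n + 1) := ∑ x, star (c x) • (onSite x (SpinOperators.spinZ n) : Op Λ (n + 1)) with hZs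
  set Z : Op Λ (n + 1) := ∑ x, c x • (onSite x (SpinOperators.spinZ n) : Op Λ (n + 1)) with hZ
  set Lt : Op Λ (n + 1) := ∑ x, (onSite x (spinLower n) : Op Λ (n + 1)) with hLt
  set Rt : Op Λ (n + 1) := ∑ x, (onSite x (spinRaise n) : Op Λ (n + 1)) with hRt
  have hLt1 : Lt = ∑ x, (1 : ℂ) • (onSite x (spinLower n) : Op Λ (n + 1)) := by
    simp only [one_smul]; rfl
  -- `[S⁺(c), Z(c)†] = -S⁺_tot`
  have hRZ : R * Zs - Zs * R = -Rt := by
    rw [hR, hZs, sum_smul_onSite_commutator]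
    have key : spinRaise n * SpinOperators.spinZ n - SpinOperators.spinZ n * spinRaise n = -spinRaise n := by
      rw [← neg_sub, spinZ_commutator_spinRaise]
    simp only [key, hc, one_smul, onSite_neg', Finset.sum_neg_distrib]
    rfl
  -- `[S⁺(c), S⁻_tot] = 2 Z(c)`
  have hRL : R * Lt - Lt * R = (2 : ℂ) • Z := by
    rw [hR, hLt1, sum_smul_onSite_commutator, hZ, Finset.smul_sum]
    refine sum_congr rfl fun x _ => ?_
    rw [spinRaise_commutator_spinLower, mul_one, onSite_smul', smul_smul, smul_smul, mul_comm]
  calc R * (Zs * Lt) - Zs * Lt * R = (R * Zs - Zs * R) * Lt + Zs * (R * Lt - Lt * R) := by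
        simp only [sub_mul, mul_sub, Matrix.mul_assoc]; abel
    _ = -Rt * Lt + Zs * ((2 : ℂ) • Z) := by rw [hRZ, hRL]
    _ = -(Rt * Lt) + (2 : ℂ) • (Zs * Z) := by rw [Matrix.neg_mul, Matrix.mul_smul]

omit [DecidableEq Λ] in
/-- `⟨ψ, Aᴴ A ψ⟩ = ‖Aψ‖₂²` as a complex number. [folklore] -/
private theorem expect_conjTranspose_mul_self {ι : Type*} [Fintype ι] [DecidableEq ι]
    (A : Matrix ι ι ℂ) (ψ : ι → ℂ) :
    star ψ ⬝ᵥ ((Aᴴ * A) *ᵥ ψ) = ((eucNorm (A *ᵥ ψ) ^ 2 : ℝ) : ℂ) := by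
  rw [← mulVec_mulVec, dotProduct_mulVec, ← star_mulVec, star_dotProduct_self_eq_eucNorm_sq]

/-- **The uncertainty-principle (Goldstone) bound with the composite probe.** For every vector `ψ`
of the spin system `(ℂ^{n+1})^{⊗Λ}` and every unimodular weight `c` (`c_x c̄_x = 1`):
`(2‖Z(c)ψ‖² - ‖S⁻_totψ‖²)² ≤ (‖S⁻(c̄)ψ‖² + ‖S⁺(c)ψ‖²)·((‖S⁻_tot Z(c)†ψ‖ + ‖S⁻(c̄)ψ‖)² + ‖S⁺_tot Z(c)ψ‖²)`,
where `S⁺(c) = Σ c_xS⁺_x`, `S⁻(c̄) = Σ c̄_xS⁻_x = S⁺(c)†`, `Z(c) = Σ c_xSᶻ_x`, `Z(c)† = Σ c̄_xSᶻ_x`.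
Proof: `norm_sq_expect_commutator_le` with `A = S⁻(c̄)`, `B = Z(c)†S⁻_tot`, the commutator
`goldstone_commutator`, and `Z(c)†S⁻_tot = S⁻_totZ(c)† - S⁻(c̄)` for the norm of `Bψ`. On a
translation-invariant state of an `N`-site torus with `c_x = e^{-ik·x}` this reads
`K̂(k)·Ĉ(k) ≥ m⁴(1 - o(1))` (order parameter `m² = ‖S⁻_totψ‖²/N²` forces transverse weight at every
momentum, Stringari's (9) in symmetric finite volume). [cite: Stringari1995, §2.2 eqs. (8)–(9)]
[cite: PitaevskiiStringari1991] -/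
theorem goldstone_uncertainty_bound (c : Λ → ℂ) (hc : ∀ x, c x * star (c x) = 1)
    (ψ : TensorIndex Λ (n + 1) → ℂ) :
    (2 * eucNorm ((∑ x, c x • (onSite x (SpinOperators.spinZ n) : Op Λ (n + 1))) *ᵥ ψ) ^ 2 -
        eucNorm ((∑ x, (onSite x (spinLower n) : Op Λ (n + 1))) *ᵥ ψ) ^ 2) ^ 2 ≤
      (eucNorm ((∑ x, star (c x) • (onSite x (spinLower n) : Op Λ (n + 1))) *ᵥ ψ) ^ 2 +
          eucNorm ((∑ x, c x • (onSite x (spinRaise n) : Op Λ (n + 1))) *ᵥ ψ) ^ 2) *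
        ((eucNorm ((∑ x, (onSite x (spinLower n) : Op Λ (n + 1))) *ᵥ
              ((∑ x, star (c x) • (onSite x (SpinOperators.spinZ n) : Op Λ (n + 1))) *ᵥ ψ)) +
            eucNorm ((∑ x, star (c x) • (onSite x (spinLower n) : Op Λ (n + 1))) *ᵥ ψ)) ^ 2 +
          eucNorm ((∑ x, (onSite x (spinRaise n) : Op Λ (n + 1))) *ᵥ
              ((∑ x, c x • (onSite x (SpinOperators.spinZ n) : Op Λ (n + 1))) *ᵥ ψ)) ^ 2) := by
  set R : Op Λ (n + 1) := ∑ x, c x • (onSite x (spinRaise n) : Op Λ (n + 1)) with hR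
  set L : Op Λ (n + 1) := ∑ x, star (c x) • (onSite x (spinLower n) : Op Λ (n + 1)) with hL
  set Zs : Op Λ (n + 1) := ∑ x, star (c x) • (onSite x (SpinOperators.spinZ n) : Op Λ (n + 1)) with hZs
  set Z : Op Λ (n + 1) := ∑ x, c x • (onSite x (SpinOperators.spinZ n) : Op Λ (n + 1)) with hZ
  set Lt : Op Λ (n + 1) := ∑ x, (onSite x (spinLower n) : Op Λ (n + 1)) with hLt
  set Rt : Op Λ (n + 1) := ∑ x, (onSite x (spinRaise n) : Op Λ (n + 1)) with hRt
  -- adjoints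
  have hLR : Lᴴ = R := by
    rw [hL, hR, conjTranspose_sum]
    refine sum_congr rfl fun x _ => ?_
    rw [conjTranspose_smul, star_star, ← onSite_conjTranspose, spinLower_eq_conjTranspose,
      conjTranspose_conjTranspose]
  have hRL : Rᴴ = L := by rw [← hLR, conjTranspose_conjTranspose]
  have hZZ : Zᴴ = Zs := by
    rw [hZ, hZs, conjTranspose_sum]
    refine sum_congr rfl fun x _ => ?_
    have hz : (SpinOperators.spinZ n)ᴴ = SpinOperators.spinZ n := (spinVec_isHermitian n 2).eq
    rw [conjTranspose_smul, ← onSite_conjTranspose, hz]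
  have hZsZ : Zsᴴ = Z := by rw [← hZZ, conjTranspose_conjTranspose]
  have hLtRt : Ltᴴ = Rt := by
    rw [hLt, hRt, conjTranspose_sum]
    refine sum_congr rfl fun x _ => ?_
    rw [← onSite_conjTranspose, spinLower_eq_conjTranspose, conjTranspose_conjTranspose]
  have hRtLt : Rtᴴ = Lt := by rw [← hLtRt, conjTranspose_conjTranspose]
  -- the probe and the commutator
  set B : Op Λ (n + 1) := Zs * Lt with hB
  have hcomm : Lᴴ * B - B * Lᴴ = -(Rt * Lt) + (2 : ℂ) • (Zs * Z) := by
    rw [hLR, hB]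
    exact goldstone_commutator n c hc
  -- `Z(c)† S⁻_tot = S⁻_tot Z(c)† - S⁻(c̄)`
  have hZsLt : Zs * Lt = Lt * Zs - L := by
    have hLt1 : Lt = ∑ x, (1 : ℂ) • (onSite x (spinLower n) : Op Λ (n + 1)) := by
      simp only [one_smul]; rfl
    have h := sum_smul_onSite_commutator (fun x => star (c x)) (fun _ => (1 : ℂ))
      (SpinOperators.spinZ n) (spinLower n) (Λ := Λ)
    simp only [spinZ_commutator_spinLower, mul_one, onSite_neg', smul_neg, Finset.sum_neg_distrib] at h
    rw [← hLt1, ← hZs, ← hL] at h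
    -- `h : Zs * Lt - Lt * Zs = -L`
    calc Zs * Lt = (Zs * Lt - Lt * Zs) + Lt * Zs := by abel
      _ = Lt * Zs - L := by rw [h]; abel
  -- the uncertainty inequality
  have key := norm_sq_expect_commutator_le L B ψ
  -- left side: the commutator expectation is the real number `2‖Zψ‖² - ‖Ltψ‖²`
  have hlhs : star ψ ⬝ᵥ ((Lᴴ * B - B * Lᴴ) *ᵥ ψ) =
      (((2 * eucNorm (Z *ᵥ ψ) ^ 2 - eucNorm (Lt *ᵥ ψ) ^ 2 : ℝ)) : ℂ) := by
    rw [hcomm, add_mulVec, neg_mulVec, smul_mulVec, dotProduct_add, dotProduct_neg,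
      dotProduct_smul, ← hLtRt, expect_conjTranspose_mul_self, ← hZZ, expect_conjTranspose_mul_self]
    push_cast
    ring
  rw [hlhs, Complex.norm_real, Real.norm_eq_abs, sq_abs] at key
  -- first factor: `‖Lψ‖² + ‖Rψ‖²`
  have hA : (star ψ ⬝ᵥ ((Lᴴ * L + L * Lᴴ) *ᵥ ψ)).re = eucNorm (L *ᵥ ψ) ^ 2 + eucNorm (R *ᵥ ψ) ^ 2 := by
    rw [add_mulVec, dotProduct_add, Complex.add_re, re_expect_conjTranspose_mul_self_eq_eucNorm_sq,
      re_expect_mul_conjTranspose_self_eq_eucNorm_sq, hLR]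
  -- second factor: `‖Bψ‖² + ‖Bᴴψ‖²`, bounded through `hZsLt`
  have hBB : (star ψ ⬝ᵥ ((Bᴴ * B + B * Bᴴ) *ᵥ ψ)).re = eucNorm (B *ᵥ ψ) ^ 2 + eucNorm (Bᴴ *ᵥ ψ) ^ 2 := by
    rw [add_mulVec, dotProduct_add, Complex.add_re, re_expect_conjTranspose_mul_self_eq_eucNorm_sq,
      re_expect_mul_conjTranspose_self_eq_eucNorm_sq]
  have hB1 : eucNorm (B *ᵥ ψ) ≤ eucNorm (Lt *ᵥ (Zs *ᵥ ψ)) + eucNorm (L *ᵥ ψ) := by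
    rw [hB, hZsLt, sub_mulVec, ← mulVec_mulVec]
    exact eucNorm_sub_le _ _
  have hB2 : eucNorm (Bᴴ *ᵥ ψ) = eucNorm (Rt *ᵥ (Z *ᵥ ψ)) := by
    rw [hB, conjTranspose_mul, hLtRt, hZsZ, ← mulVec_mulVec]
  have hB0 : 0 ≤ eucNorm (B *ᵥ ψ) := eucNorm_nonneg _
  have hBle : (star ψ ⬝ᵥ ((Bᴴ * B + B * Bᴴ) *ᵥ ψ)).re ≤
      (eucNorm (Lt *ᵥ (Zs *ᵥ ψ)) + eucNorm (L *ᵥ ψ)) ^ 2 + eucNorm (Rt *ᵥ (Z *ᵥ ψ)) ^ 2 := by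
    rw [hBB, hB2]
    have := pow_le_pow_left₀ hB0 hB1 2
    linarith
  have hA0 : 0 ≤ eucNorm (L *ᵥ ψ) ^ 2 + eucNorm (R *ᵥ ψ) ^ 2 := add_nonneg (sq_nonneg _) (sq_nonneg _)
  rw [hA] at key
  exact key.trans (mul_le_mul_of_nonneg_left hBle hA0)

/-! ### Spin ½: explicit bounds on the total lowering / raising operators -/

section SpinHalf

/-- **Spin ½: `S⁺S⁻ + S⁻S⁺ = 1`** (`= 2(𝐒² - (Sᶻ)²) = 2(¾ - ¼)`). Tasaki (2020) §2.1, eq. (2.1.8).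
[cite: Tasaki2020, §2.1 eq. (2.1.8)] -/
theorem spinRaise_one_mul_spinLower_one_add :
    spinRaise 1 * spinLower 1 + spinLower 1 * spinRaise 1 = 1 := by
  ext k l
  simp only [Matrix.add_apply, Matrix.mul_apply, Fin.sum_univ_succ, Finset.univ_eq_empty,
    Finset.sum_empty, spinRaise_apply, spinLower_apply, Matrix.one_apply]
  fin_cases k <;> fin_cases l <;> norm_num

/-- **Spin ½, one site: `‖S⁻_xφ‖² + ‖S⁺_xφ‖² = ‖φ‖²`** for every vector `φ` (from `S⁺S⁻ + S⁻S⁺ = 1`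
at the site `x`). [folklore] -/
theorem eucNorm_sq_onSite_spinLower_one_add (x : Λ) (φ : TensorIndex Λ (1 + 1) → ℂ) :
    eucNorm ((onSite x (spinLower 1) : Op Λ (1 + 1)) *ᵥ φ) ^ 2 +
        eucNorm ((onSite x (spinRaise 1) : Op Λ (1 + 1)) *ᵥ φ) ^ 2 = eucNorm φ ^ 2 := by
  have hL : ((onSite x (spinLower 1) : Op Λ (1 + 1)))ᴴ = onSite x (spinRaise 1) := by
    rw [← onSite_conjTranspose, spinLower_eq_conjTranspose, conjTranspose_conjTranspose]
  have hR : ((onSite x (spinRaise 1) : Op Λ (1 + 1)))ᴴ = onSite x (spinLower 1) := by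
    rw [← onSite_conjTranspose, spinLower_eq_conjTranspose]
  have h1 := re_expect_conjTranspose_mul_self_eq_eucNorm_sq (onSite x (spinLower 1) : Op Λ (1 + 1)) φ
  have h2 := re_expect_conjTranspose_mul_self_eq_eucNorm_sq (onSite x (spinRaise 1) : Op Λ (1 + 1)) φ
  rw [hL] at h1
  rw [hR] at h2
  have hsum : (onSite x (spinRaise 1) : Op Λ (1 + 1)) * onSite x (spinLower 1) +
      (onSite x (spinLower 1) : Op Λ (1 + 1)) * onSite x (spinRaise 1) = 1 := by
    rw [onSite_mul, onSite_mul, ← onSite_add', spinRaise_one_mul_spinLower_one_add, onSite_one']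
  rw [← h1, ← h2, ← Complex.add_re, ← dotProduct_add, ← add_mulVec, hsum, one_mulVec, eucNorm_sq]

/-- Spin ½: `‖S⁻_x φ‖ ≤ ‖φ‖`. [folklore] -/
theorem eucNorm_onSite_spinLower_one_mulVec_le (x : Λ) (φ : TensorIndex Λ (1 + 1) → ℂ) :
    eucNorm ((onSite x (spinLower 1) : Op Λ (1 + 1)) *ᵥ φ) ≤ eucNorm φ := by
  have h := eucNorm_sq_onSite_spinLower_one_add x φ
  have h2 : eucNorm ((onSite x (spinLower 1) : Op Λ (1 + 1)) *ᵥ φ) ^ 2 ≤ eucNorm φ ^ 2 := by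
    rw [← h]; nlinarith [sq_nonneg (eucNorm ((onSite x (spinRaise 1) : Op Λ (1 + 1)) *ᵥ φ))]
  exact (pow_le_pow_iff_left₀ (eucNorm_nonneg _) (eucNorm_nonneg _) two_ne_zero).mp h2

/-- Spin ½: `‖S⁺_x φ‖ ≤ ‖φ‖`. [folklore] -/
theorem eucNorm_onSite_spinRaise_one_mulVec_le (x : Λ) (φ : TensorIndex Λ (1 + 1) → ℂ) :
    eucNorm ((onSite x (spinRaise 1) : Op Λ (1 + 1)) *ᵥ φ) ≤ eucNorm φ := by
  have h := eucNorm_sq_onSite_spinLower_one_add x φ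
  have h2 : eucNorm ((onSite x (spinRaise 1) : Op Λ (1 + 1)) *ᵥ φ) ^ 2 ≤ eucNorm φ ^ 2 := by
    rw [← h]; nlinarith [sq_nonneg (eucNorm ((onSite x (spinLower 1) : Op Λ (1 + 1)) *ᵥ φ))]
  exact (pow_le_pow_iff_left₀ (eucNorm_nonneg _) (eucNorm_nonneg _) two_ne_zero).mp h2

/-- **Spin ½: `‖S⁻_tot φ‖ ≤ |Λ| ‖φ‖`** (triangle inequality over the sites). [folklore] -/
theorem eucNorm_sum_onSite_spinLower_one_mulVec_le (φ : TensorIndex Λ (1 + 1) → ℂ) :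
    eucNorm ((∑ x, (onSite x (spinLower 1) : Op Λ (1 + 1))) *ᵥ φ) ≤ Fintype.card Λ * eucNorm φ := by
  rw [Matrix.sum_mulVec]
  calc eucNorm (∑ x, (onSite x (spinLower 1) : Op Λ (1 + 1)) *ᵥ φ)
      ≤ ∑ x, eucNorm ((onSite x (spinLower 1) : Op Λ (1 + 1)) *ᵥ φ) :=
        Finset.le_sum_of_subadditive eucNorm (le_of_eq eucNorm_zero) eucNorm_add_le _ _
    _ ≤ ∑ _x : Λ, eucNorm φ := Finset.sum_le_sum fun x _ => eucNorm_onSite_spinLower_one_mulVec_le x φ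
    _ = Fintype.card Λ * eucNorm φ := by rw [Finset.sum_const, Finset.card_univ, nsmul_eq_mul]

/-- **Spin ½: `‖S⁺_tot φ‖ ≤ |Λ| ‖φ‖`.** [folklore] -/
theorem eucNorm_sum_onSite_spinRaise_one_mulVec_le (φ : TensorIndex Λ (1 + 1) → ℂ) :
    eucNorm ((∑ x, (onSite x (spinRaise 1) : Op Λ (1 + 1))) *ᵥ φ) ≤ Fintype.card Λ * eucNorm φ := by
  rw [Matrix.sum_mulVec]
  calc eucNorm (∑ x, (onSite x (spinRaise 1) : Op Λ (1 + 1)) *ᵥ φ)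
      ≤ ∑ x, eucNorm ((onSite x (spinRaise 1) : Op Λ (1 + 1)) *ᵥ φ) :=
        Finset.le_sum_of_subadditive eucNorm (le_of_eq eucNorm_zero) eucNorm_add_le _ _
    _ ≤ ∑ _x : Λ, eucNorm φ := Finset.sum_le_sum fun x _ => eucNorm_onSite_spinRaise_one_mulVec_le x φ
    _ = Fintype.card Λ * eucNorm φ := by rw [Finset.sum_const, Finset.card_univ, nsmul_eq_mul]

/-- Monotonicity step used below (real arithmetic). [folklore] -/
private theorem mono_step {X F a b d N a' d' : ℝ} (hkey : X ≤ F * ((a + b) ^ 2 + d ^ 2))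
    (h1 : a ≤ N * a') (h2 : d ≤ N * d') (ha : 0 ≤ a) (hb : 0 ≤ b) (hd : 0 ≤ d) (hF : 0 ≤ F) :
    X ≤ F * ((N * a' + b) ^ 2 + (N * d') ^ 2) :=
  hkey.trans (mul_le_mul_of_nonneg_left
    (add_le_add (pow_le_pow_left₀ (add_nonneg ha hb) (add_le_add h1 le_rfl) 2)
      (pow_le_pow_left₀ hd h2 2)) hF)

/-- **The Goldstone uncertainty bound for spin ½ with explicit constants**: for every vector `ψ` of
`(ℂ²)^{⊗Λ}`, `N = |Λ|`, and every unimodular weight `c`,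
`(2‖Z(c)ψ‖² - ‖S⁻_totψ‖²)² ≤ (‖S⁻(c̄)ψ‖² + ‖S⁺(c)ψ‖²)·((N‖Z(c)†ψ‖ + ‖S⁻(c̄)ψ‖)² + (N‖Z(c)ψ‖)²)`
(`goldstone_uncertainty_bound` with `‖S^∓_tot φ‖ ≤ N‖φ‖`). On a translation-invariant `Sᶻ_tot = 0`
state of an `N`-site torus with `c_x = e^{-ik·x}`: `(N²m² - 2NĈ(k))² ≤ 2N K̂(k)·((N√(NĈ) + √(NK̂))² + N³Ĉ)`,
i.e. `K̂(k)Ĉ(k) ≥ ¼m⁴(1 - o(1))` — Stringari's (9) in symmetric finite volume.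
[cite: Stringari1995, §2.2 eqs. (8)–(9)] [cite: PitaevskiiStringari1991] -/
theorem goldstone_uncertainty_bound_spinHalf (c : Λ → ℂ) (hc : ∀ x, c x * star (c x) = 1)
    (ψ : TensorIndex Λ (1 + 1) → ℂ) :
    (2 * eucNorm ((∑ x, c x • (onSite x (SpinOperators.spinZ 1) : Op Λ (1 + 1))) *ᵥ ψ) ^ 2 -
        eucNorm ((∑ x, (onSite x (spinLower 1) : Op Λ (1 + 1))) *ᵥ ψ) ^ 2) ^ 2 ≤
      (eucNorm ((∑ x, star (c x) • (onSite x (spinLower 1) : Op Λ (1 + 1))) *ᵥ ψ) ^ 2 +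
          eucNorm ((∑ x, c x • (onSite x (spinRaise 1) : Op Λ (1 + 1))) *ᵥ ψ) ^ 2) *
        ((Fintype.card Λ * eucNorm ((∑ x, star (c x) • (onSite x (SpinOperators.spinZ 1) : Op Λ (1 + 1))) *ᵥ ψ) +
            eucNorm ((∑ x, star (c x) • (onSite x (spinLower 1) : Op Λ (1 + 1))) *ᵥ ψ)) ^ 2 +
          (Fintype.card Λ * eucNorm ((∑ x, c x • (onSite x (SpinOperators.spinZ 1) : Op Λ (1 + 1))) *ᵥ ψ)) ^ 2) := by
  have h1 := eucNorm_sum_onSite_spinLower_one_mulVec_le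
    ((∑ x, star (c x) • (onSite x (SpinOperators.spinZ 1) : Op Λ (1 + 1))) *ᵥ ψ)
  have h2 := eucNorm_sum_onSite_spinRaise_one_mulVec_le
    ((∑ x, c x • (onSite x (SpinOperators.spinZ 1) : Op Λ (1 + 1))) *ᵥ ψ)
  have key := goldstone_uncertainty_bound 1 c hc ψ
  exact mono_step key h1 h2 (eucNorm_nonneg _) (eucNorm_nonneg _) (eucNorm_nonneg _)
    (add_nonneg (sq_nonneg _) (sq_nonneg _))

end SpinHalf

end Literature.MathematicalPhysics.QuantumLattice
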